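import Literature.Analysis.FluidPDE.KNSSProp41OfLocal
import Literature.Analysis.FluidPDE.KNSSRegularityPlanarOfSpace
import HarnessLib

/-!
# KNSS 2009: §4 in the plane and Theorem 5.1 from the local smoothing fact (L) alone

Glue file (everything proved; no definitions, no named facts) recording the current trust base
of the planar regularity fact `Literature.Analysis.FluidPDE.KNSS2009_regularity_boundedWeak_ancient_planar`
(`KNSSRegularityPlanar.lean`; Koch–Nadirashvili–Seregin–Šverák, Acta Math. 203 (2009) =
arXiv:0709.3599, §4 for bounded weak solutions on `ℝ² × (−∞, 0)`) and of Theorem 5.1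
(`KNSS2009_liouville_planar`, `KNSSLiouville.lean`). The planar fact is a consequence of the
spatial one (`KNSS2009_regularity_boundedWeak_ancient_planar_of_ancient`,
`KNSSRegularityPlanarOfSpace.lean`: lift `u ↦ (u ∘ π, 0)`), and the spatial one rests on the
single named fact (L) `knss2009_local_smoothing ℝ³` — KNSS's Proposition 4.1 in quantitative
short-time form (`NSBoundedMildSmoothing.lean`) — by `KNSS2009_regularity_boundedWeak_ancient_of_local`
(`KNSSProp41OfLocal.lean`: Lemma 3.1, Galilean covariance, the vorticity equation (4.8) and
Proposition 4.1-from-(L) all proved in the tree). Composing: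

* `KNSS2009_regularity_boundedWeak_ancient_planar_of_local :
    knss2009_local_smoothing ℝ³ → KNSS2009_regularity_boundedWeak_ancient_planar`;
* `KNSS2009_liouville_planar_of_local : knss2009_local_smoothing ℝ³ → KNSS2009_liouville_planar`.

So KNSS's Theorem 5.1 as printed, like Theorems 5.2–5.3, is proved in the tree from (L) alone.

## References

* G. Koch, N. Nadirashvili, G. Seregin, V. Šverák, *Liouville theorems for the Navier–Stokes
  equations and applications*, Acta Math. 203 (2009) 83–105 = arXiv:0709.3599: §4 p. 8
  (Prop. 4.1, the closing paragraph (4.7)–(4.11)); §5 Theorem 5.1, p. 9.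
  [KochNadirashviliSereginSverak2009]
-/

noncomputable section

namespace Literature.Analysis.FluidPDE

/-- **KNSS 2009, §4 for bounded weak solutions on `ℝ² × (−∞, 0)` from the local smoothing fact
(L) alone**: the planar ancient regularity fact follows from `knss2009_local_smoothing ℝ³`
(Prop. 4.1, quantitative short-time form) through the spatial fact
(`KNSS2009_regularity_boundedWeak_ancient_of_local`) and the planar lift
(`KNSS2009_regularity_boundedWeak_ancient_planar_of_ancient`). [cite: KochNadirashviliSereginSverak2009, §4 p. 8 (Prop. 4.1 and the closing paragraph) with §5 proof of Thm 5.1 (arXiv p. 9)] -/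
theorem KNSS2009_regularity_boundedWeak_ancient_planar_of_local
    (hL : knss2009_local_smoothing (EuclideanSpace ℝ (Fin 3))) :
    KNSS2009_regularity_boundedWeak_ancient_planar :=
  KNSS2009_regularity_boundedWeak_ancient_planar_of_ancient
    (KNSS2009_regularity_boundedWeak_ancient_of_local hL)

/-- **KNSS 2009, Theorem 5.1 from the local smoothing fact (L) alone**: a bounded weak solution
of the Navier–Stokes equations in `ℝ² × (−∞, 0)` is of the form `u(x, t) = b(t)`
(`KNSS2009_liouville_planar`), granted `knss2009_local_smoothing ℝ³`. [cite: KochNadirashviliSereginSverak2009, Thm 5.1 (arXiv p. 9)] -/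
theorem KNSS2009_liouville_planar_of_local
    (hL : knss2009_local_smoothing (EuclideanSpace ℝ (Fin 3))) : KNSS2009_liouville_planar :=
  KNSS2009_liouville_planar_of_ancient (KNSS2009_regularity_boundedWeak_ancient_of_local hL)

end Literature.Analysis.FluidPDE

end
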